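import Summits.Ventures.HSemireg.Pad4TowerLineDesignCert12Closure

/-!
# Pad4Tower ∕ LineDesignCert12 — KERNEL DECIDES (6∕7, `XPlus3`): guarded X⁺ (the `X` family of the dual-0 world `cfgd`) at dual heads of chunks 41–59 of 78

Tree cut of the KERNEL CERTIFICATE `Cert12`: the `decide +kernel` theorems of this module are, by NAME, STATEMENT and PROOF, those of the farm-certified
Cruxes-level parts `CeilingLineCert12A–E` (split5); the module boundary is set by the gate's build budget only. Each theorem is one static-family check at a few
heads of the design `cfg` of `Pad4TowerLineDesignCert12Closure`; the assembly is in `Pad4TowerLineDesignCert12`.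

MODULE SET (tree cut of ONE certificate; one namespace `Summit.Ventures.HSemireg.Pad4Tower.LineDesignCert12`): `…Cert12DataN` ∕ `DataP` ∕ `DataPd` ∕ `DataNd` (the support and its literal
dual-0 world, DATA ONLY) → `…Cert12Closure` (key-chain `Nodup`, the design `cfg`, the literal dual `cfgd` and `cfg_dual_eq`, ◇₁₂, the ceiling line, per-chunk
G₁ closure ⇒ `cfg` is Δ- and S₄-closed) → `…Cert12RuleD1` ∕ `…Cert12RuleD2` ∕ `…Cert12RuleD3` ∕ `…Cert12XPlus1` ∕ `…Cert12XPlus2` ∕ `…Cert12XPlus3` ∕ `…Cert12XPlus4` (the RULE D (μ₄, M) resp. guarded X⁺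
decides, a few heads per theorem, module boundaries set by the gate's build budget only) → `Pad4TowerLineDesignCert12` (assembly `cfg_staticH1` and the
UNCONDITIONAL doors `¬ SeedB1OddDiamondG1H1 12`, `¬ SeedB1OddConeG1H1`, `¬ SeedB1OddDiamondG1H1 h'` (12 ≤ h'), the LINE shape, every support cell's realisability).

NOTHING IN THIS MODULE SET SAYS THAT HC ∕ HC_CM ∕ HC_AV ∕ H2 ∕ stmt-HodgeConjecture-18881 HOLDS OR FAILS (HC_CM is a displayed binder of the
ladder only); the certified statements concern the typed FIRST-ORDER static game (`RuleDMu4Closed`, `XPlusClosed`, `A2IMinusClosed` = `MConfig.StaticH1`)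
of ONE explicit finite support — first order is necessary, not sufficient, for a seed; no σ, no seed, no census row. `decide +kernel` only: NO `native_decide`,
no `sorry`, no `axiom`, no `instance`, no notation, no Literature fact, no new `def … : Prop`.
-/

set_option linter.dupNamespace false

namespace Summit.Ventures.HSemireg.Pad4Tower.LineDesignCert12

open Summit.Ventures.HSemireg Summit.Ventures.HSemireg.Pad4Tower

set_option maxRecDepth 32768
set_option Elab.async false
set_option synthInstance.maxSize 8192
set_option synthInstance.maxHeartbeats 2000000
set_option maxHeartbeats 8000000

/-! guarded X⁺ (the `X` family of the dual-0 world `cfgd`), heads chunked (6 per theorem) -/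

/-- no `X`-family instance of the dual-0 world fires at the heads of dual chunk 41∕78 (guarded form, `xresXClosed_iff_guarded'`). [kernel `decide`] -/
theorem xplus_41 : ∀ Z ∈ lPd_41, ∀ σ : Fin 4, ¬ isApex (Z σ) → ∀ u : Fin 4, ∀ q ∈ sNd, UPartner Z q σ u → ∀ w : Fin 4, ∀ n ∈ sPd,
    Sibling q n σ w → ∀ f : Fin 4, ¬ XresXFires cfgd Z q n σ u w f := by decide +kernel
/-- no `X`-family instance of the dual-0 world fires at the heads of dual chunk 42∕78 (guarded form, `xresXClosed_iff_guarded'`). [kernel `decide`] -/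
theorem xplus_42 : ∀ Z ∈ lPd_42, ∀ σ : Fin 4, ¬ isApex (Z σ) → ∀ u : Fin 4, ∀ q ∈ sNd, UPartner Z q σ u → ∀ w : Fin 4, ∀ n ∈ sPd,
    Sibling q n σ w → ∀ f : Fin 4, ¬ XresXFires cfgd Z q n σ u w f := by decide +kernel
/-- no `X`-family instance of the dual-0 world fires at the heads of dual chunk 43∕78 (guarded form, `xresXClosed_iff_guarded'`). [kernel `decide`] -/
theorem xplus_43 : ∀ Z ∈ lPd_43, ∀ σ : Fin 4, ¬ isApex (Z σ) → ∀ u : Fin 4, ∀ q ∈ sNd, UPartner Z q σ u → ∀ w : Fin 4, ∀ n ∈ sPd,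
    Sibling q n σ w → ∀ f : Fin 4, ¬ XresXFires cfgd Z q n σ u w f := by decide +kernel
/-- no `X`-family instance of the dual-0 world fires at the heads of dual chunk 44∕78 (guarded form, `xresXClosed_iff_guarded'`). [kernel `decide`] -/
theorem xplus_44 : ∀ Z ∈ lPd_44, ∀ σ : Fin 4, ¬ isApex (Z σ) → ∀ u : Fin 4, ∀ q ∈ sNd, UPartner Z q σ u → ∀ w : Fin 4, ∀ n ∈ sPd,
    Sibling q n σ w → ∀ f : Fin 4, ¬ XresXFires cfgd Z q n σ u w f := by decide +kernel
/-- no `X`-family instance of the dual-0 world fires at the heads of dual chunk 45∕78 (guarded form, `xresXClosed_iff_guarded'`). [kernel `decide`] -/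
theorem xplus_45 : ∀ Z ∈ lPd_45, ∀ σ : Fin 4, ¬ isApex (Z σ) → ∀ u : Fin 4, ∀ q ∈ sNd, UPartner Z q σ u → ∀ w : Fin 4, ∀ n ∈ sPd,
    Sibling q n σ w → ∀ f : Fin 4, ¬ XresXFires cfgd Z q n σ u w f := by decide +kernel
/-- no `X`-family instance of the dual-0 world fires at the heads of dual chunk 46∕78 (guarded form, `xresXClosed_iff_guarded'`). [kernel `decide`] -/
theorem xplus_46 : ∀ Z ∈ lPd_46, ∀ σ : Fin 4, ¬ isApex (Z σ) → ∀ u : Fin 4, ∀ q ∈ sNd, UPartner Z q σ u → ∀ w : Fin 4, ∀ n ∈ sPd,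
    Sibling q n σ w → ∀ f : Fin 4, ¬ XresXFires cfgd Z q n σ u w f := by decide +kernel
/-- no `X`-family instance of the dual-0 world fires at the heads of dual chunk 47∕78 (guarded form, `xresXClosed_iff_guarded'`). [kernel `decide`] -/
theorem xplus_47 : ∀ Z ∈ lPd_47, ∀ σ : Fin 4, ¬ isApex (Z σ) → ∀ u : Fin 4, ∀ q ∈ sNd, UPartner Z q σ u → ∀ w : Fin 4, ∀ n ∈ sPd,
    Sibling q n σ w → ∀ f : Fin 4, ¬ XresXFires cfgd Z q n σ u w f := by decide +kernel
/-- no `X`-family instance of the dual-0 world fires at the heads of dual chunk 48∕78 (guarded form, `xresXClosed_iff_guarded'`). [kernel `decide`] -/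
theorem xplus_48 : ∀ Z ∈ lPd_48, ∀ σ : Fin 4, ¬ isApex (Z σ) → ∀ u : Fin 4, ∀ q ∈ sNd, UPartner Z q σ u → ∀ w : Fin 4, ∀ n ∈ sPd,
    Sibling q n σ w → ∀ f : Fin 4, ¬ XresXFires cfgd Z q n σ u w f := by decide +kernel
/-- no `X`-family instance of the dual-0 world fires at the heads of dual chunk 49∕78 (guarded form, `xresXClosed_iff_guarded'`). [kernel `decide`] -/
theorem xplus_49 : ∀ Z ∈ lPd_49, ∀ σ : Fin 4, ¬ isApex (Z σ) → ∀ u : Fin 4, ∀ q ∈ sNd, UPartner Z q σ u → ∀ w : Fin 4, ∀ n ∈ sPd,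
    Sibling q n σ w → ∀ f : Fin 4, ¬ XresXFires cfgd Z q n σ u w f := by decide +kernel
/-- no `X`-family instance of the dual-0 world fires at the heads of dual chunk 50∕78 (guarded form, `xresXClosed_iff_guarded'`). [kernel `decide`] -/
theorem xplus_50 : ∀ Z ∈ lPd_50, ∀ σ : Fin 4, ¬ isApex (Z σ) → ∀ u : Fin 4, ∀ q ∈ sNd, UPartner Z q σ u → ∀ w : Fin 4, ∀ n ∈ sPd,
    Sibling q n σ w → ∀ f : Fin 4, ¬ XresXFires cfgd Z q n σ u w f := by decide +kernel
/-- no `X`-family instance of the dual-0 world fires at the heads of dual chunk 51∕78 (guarded form, `xresXClosed_iff_guarded'`). [kernel `decide`] -/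
theorem xplus_51 : ∀ Z ∈ lPd_51, ∀ σ : Fin 4, ¬ isApex (Z σ) → ∀ u : Fin 4, ∀ q ∈ sNd, UPartner Z q σ u → ∀ w : Fin 4, ∀ n ∈ sPd,
    Sibling q n σ w → ∀ f : Fin 4, ¬ XresXFires cfgd Z q n σ u w f := by decide +kernel
/-- no `X`-family instance of the dual-0 world fires at the heads of dual chunk 52∕78 (guarded form, `xresXClosed_iff_guarded'`). [kernel `decide`] -/
theorem xplus_52 : ∀ Z ∈ lPd_52, ∀ σ : Fin 4, ¬ isApex (Z σ) → ∀ u : Fin 4, ∀ q ∈ sNd, UPartner Z q σ u → ∀ w : Fin 4, ∀ n ∈ sPd,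
    Sibling q n σ w → ∀ f : Fin 4, ¬ XresXFires cfgd Z q n σ u w f := by decide +kernel
/-- no `X`-family instance of the dual-0 world fires at the heads of dual chunk 53∕78 (guarded form, `xresXClosed_iff_guarded'`). [kernel `decide`] -/
theorem xplus_53 : ∀ Z ∈ lPd_53, ∀ σ : Fin 4, ¬ isApex (Z σ) → ∀ u : Fin 4, ∀ q ∈ sNd, UPartner Z q σ u → ∀ w : Fin 4, ∀ n ∈ sPd,
    Sibling q n σ w → ∀ f : Fin 4, ¬ XresXFires cfgd Z q n σ u w f := by decide +kernel
/-- no `X`-family instance of the dual-0 world fires at the heads of dual chunk 54∕78 (guarded form, `xresXClosed_iff_guarded'`). [kernel `decide`] -/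
theorem xplus_54 : ∀ Z ∈ lPd_54, ∀ σ : Fin 4, ¬ isApex (Z σ) → ∀ u : Fin 4, ∀ q ∈ sNd, UPartner Z q σ u → ∀ w : Fin 4, ∀ n ∈ sPd,
    Sibling q n σ w → ∀ f : Fin 4, ¬ XresXFires cfgd Z q n σ u w f := by decide +kernel
/-- no `X`-family instance of the dual-0 world fires at the heads of dual chunk 55∕78 (guarded form, `xresXClosed_iff_guarded'`). [kernel `decide`] -/
theorem xplus_55 : ∀ Z ∈ lPd_55, ∀ σ : Fin 4, ¬ isApex (Z σ) → ∀ u : Fin 4, ∀ q ∈ sNd, UPartner Z q σ u → ∀ w : Fin 4, ∀ n ∈ sPd,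
    Sibling q n σ w → ∀ f : Fin 4, ¬ XresXFires cfgd Z q n σ u w f := by decide +kernel
/-- no `X`-family instance of the dual-0 world fires at the heads of dual chunk 56∕78 (guarded form, `xresXClosed_iff_guarded'`). [kernel `decide`] -/
theorem xplus_56 : ∀ Z ∈ lPd_56, ∀ σ : Fin 4, ¬ isApex (Z σ) → ∀ u : Fin 4, ∀ q ∈ sNd, UPartner Z q σ u → ∀ w : Fin 4, ∀ n ∈ sPd,
    Sibling q n σ w → ∀ f : Fin 4, ¬ XresXFires cfgd Z q n σ u w f := by decide +kernel
/-- no `X`-family instance of the dual-0 world fires at the heads of dual chunk 57∕78 (guarded form, `xresXClosed_iff_guarded'`). [kernel `decide`] -/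
theorem xplus_57 : ∀ Z ∈ lPd_57, ∀ σ : Fin 4, ¬ isApex (Z σ) → ∀ u : Fin 4, ∀ q ∈ sNd, UPartner Z q σ u → ∀ w : Fin 4, ∀ n ∈ sPd,
    Sibling q n σ w → ∀ f : Fin 4, ¬ XresXFires cfgd Z q n σ u w f := by decide +kernel
/-- no `X`-family instance of the dual-0 world fires at the heads of dual chunk 58∕78 (guarded form, `xresXClosed_iff_guarded'`). [kernel `decide`] -/
theorem xplus_58 : ∀ Z ∈ lPd_58, ∀ σ : Fin 4, ¬ isApex (Z σ) → ∀ u : Fin 4, ∀ q ∈ sNd, UPartner Z q σ u → ∀ w : Fin 4, ∀ n ∈ sPd,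
    Sibling q n σ w → ∀ f : Fin 4, ¬ XresXFires cfgd Z q n σ u w f := by decide +kernel
/-- no `X`-family instance of the dual-0 world fires at the heads of dual chunk 59∕78 (guarded form, `xresXClosed_iff_guarded'`). [kernel `decide`] -/
theorem xplus_59 : ∀ Z ∈ lPd_59, ∀ σ : Fin 4, ¬ isApex (Z σ) → ∀ u : Fin 4, ∀ q ∈ sNd, UPartner Z q σ u → ∀ w : Fin 4, ∀ n ∈ sPd,
    Sibling q n σ w → ∀ f : Fin 4, ¬ XresXFires cfgd Z q n σ u w f := by decide +kernel

end Summit.Ventures.HSemireg.Pad4Tower.LineDesignCert12
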